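import Mathlib
import HarnessLib
import Summits.AtomisticToContinuum.Crystallization.Theorems.PricedLinkCensusSoftFourRingsFourCycle

/-!
# Three short steps and one double step cannot close up around a circle

Route `PricedLinkCensus`, item `SoftFourRings` (stmt-AtomisticToContinuum-14234), blueprint step 3(B)
(evidence `softrings-search.md` §3, §7): the circle-geometry half of the lemma "no link vertex of type
`(3,3,3,4)`" — a site whose four link-neighbours `w₀ ∼ w₁ ∼ w₂ ∼ w₃` form a bonded path while `w₃`
and `w₀` have a further common bonded neighbour `x`.  Six of the fourteen candidate 4-regular
planar link types die by it (and three more that `no_bonded_four_cycle` already kills).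

Four angles (tangent directions at the site) pairwise `≥ g₀` apart on the circle, with the three
path steps of circular length `≤ g₁` and the closing pair `{θ₃, θ₀}` of circular length `≤ 2 g₁`
(it is bridged by `x`), are impossible when `π/3 < g₀`, `2 g₀ ≤ π`, `0 ≤ g₁ < 2 g₀` and
`5 g₁ < 2π`: sorted around the circle the gaps are `≥ g₀`, hence each `< π`; a path step is
sorted-adjacent (a diagonal already exceeds `2 g₀ > g₁`), so the path runs around the circle
monotonically and the closing pair owns the fourth gap; `2π = Σ gaps ≤ 3 g₁ + 2 g₁ < 2π`.
At `η = 1/100`: `g₀ = 68.6°`, `g₁ = 71.89°`, `5 g₁ = 359.47°`.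

Companion of `PricedLinkCensusSoftFourRingsFourCycle` (same sorting device); the sphere-to-circle
step with the sharp corner bound `g₁` is in `PricedLinkCensusSoftFourRingsThreeTriQuad`.
-/

namespace Summit.AtomisticToContinuum.Crystallization.Theorems

open Real

/-- If `cos a ≥ K ≥ 0` and `cos b ≥ K` then `cos (a − b) ≥ 2K² − 1` (two arcs of length
`≤ arccos K ≤ π/2` from a common point span at most `2 arccos K`). [folklore] -/
theorem two_mul_sq_sub_one_le_cos_sub {a b K : ℝ} (hK : 0 ≤ K) (ha : K ≤ cos a) (hb : K ≤ cos b) :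
    2 * K ^ 2 - 1 ≤ cos (a - b) := by
  rw [cos_sub]
  have h1 : K ^ 2 ≤ cos a * cos b := by nlinarith [mul_le_mul ha hb hK (hK.trans ha)]
  have hKa : K ^ 2 ≤ cos a ^ 2 := by nlinarith
  have hKb : K ^ 2 ≤ cos b ^ 2 := by nlinarith
  have hK1 : K ^ 2 ≤ 1 := hKa.trans (cos_sq_le_one a)
  have h2 : (sin a * sin b) ^ 2 ≤ (1 - K ^ 2) ^ 2 := by
    rw [mul_pow, sin_sq, sin_sq, sq (1 - K ^ 2)]
    exact mul_le_mul (by linarith) (by linarith) (by nlinarith [cos_sq_le_one b]) (by linarith)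
  have h3 := abs_le_of_sq_le_sq' h2 (by linarith)
  linarith [h3.1]

/-- Two distinct elements of `Fin 4` (= ℤ/4) are cyclically consecutive or one of the two
"diagonal" pairs `{0, 2}`, `{1, 3}`. [folklore] -/
theorem fin_four_adj_or_diag (a b : Fin 4) (hab : a ≠ b) :
    (b = a + 1 ∨ a = b + 1) ∨ (a = 0 ∧ b = 2) ∨ (a = 2 ∧ b = 0) ∨ (a = 1 ∧ b = 3) ∨
      (a = 3 ∧ b = 1) := by
  revert a b
  decide

/-- A path `a ∼ b ∼ c ∼ d` of cyclically consecutive residues mod `4` with `a ≠ c`, `b ≠ d` runs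
monotonically around `ℤ/4` (so its ends `d`, `a` are consecutive as well). [folklore] -/
theorem fin_four_path_dihedral (a b c d : Fin 4) (hac : a ≠ c) (hbd : b ≠ d)
    (h1 : b = a + 1 ∨ a = b + 1) (h2 : c = b + 1 ∨ b = c + 1) (h3 : d = c + 1 ∨ c = d + 1) :
    (b = a + 1 ∧ c = b + 1 ∧ d = c + 1 ∧ a = d + 1) ∨
      (a = b + 1 ∧ b = c + 1 ∧ c = d + 1 ∧ d = a + 1) := by
  revert a b c d
  decide

/-- **Three steps and a double step do not close up (sorted form).**  `π/3 < g₀`, `2 g₀ ≤ π`,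
`0 ≤ g₁ < 2 g₀`, `5 g₁ < 2π`; sorted angles `t₀ < ⋯ < t₃` in `(−π, π]`, pairwise
`cos (t i − t j) ≤ cos g₀`; an injective placement `q : Fin 4 → Fin 4` of four labels such that
the label pairs `{0,1}, {1,2}, {2,3}` sit at circular distance `≤ g₁`
(`cos g₁ ≤ cos (t (q (k+1)) − t (q k))`) and the pair `{3, 0}` at circular distance `≤ 2 g₁`
(`cos (2 g₁) ≤ cos (t (q 0) − t (q 3))`) — does not exist. [folklore] -/
theorem four_sorted_path_false {g₀ g₁ : ℝ} (hg₀ : π / 3 < g₀) (h2g₀ : 2 * g₀ ≤ π)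
    (hg₁0 : 0 ≤ g₁) (hg₁₀ : g₁ < 2 * g₀) (h5 : 5 * g₁ < 2 * π) (t : Fin 4 → ℝ)
    (hmono : StrictMono t) (hlo : -π < t 0) (hhi : t 3 ≤ π)
    (hsep : ∀ i j, i ≠ j → cos (t i - t j) ≤ cos g₀) (q : Fin 4 → Fin 4)
    (hq : Function.Injective q) (hb01 : cos g₁ ≤ cos (t (q 1) - t (q 0)))
    (hb12 : cos g₁ ≤ cos (t (q 2) - t (q 1))) (hb23 : cos g₁ ≤ cos (t (q 3) - t (q 2)))
    (hx : cos (2 * g₁) ≤ cos (t (q 0) - t (q 3))) : False := by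
  have hπ := pi_pos
  obtain ⟨g1lo, g2lo, g3lo, g30hi, hd02, hd13⟩ := four_sorted_gaps hg₀ h2g₀ t hmono hlo hhi hsep
  have hg₁π : g₁ ≤ π := by linarith
  have h2g₁π : 2 * g₁ ≤ π := by linarith
  -- diagonals are too long to be path steps
  have hcos2 : cos (2 * g₀) < cos g₁ := cos_lt_cos_of_nonneg_of_le_pi hg₁0 h2g₀ hg₁₀
  have nb02 : ¬ cos g₁ ≤ cos (t 2 - t 0) := fun h => by linarith
  have nb20 : ¬ cos g₁ ≤ cos (t 0 - t 2) := fun h => by rw [cos_sub_rev] at h; linarith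
  have nb13 : ¬ cos g₁ ≤ cos (t 3 - t 1) := fun h => by linarith
  have nb31 : ¬ cos g₁ ≤ cos (t 1 - t 3) := fun h => by rw [cos_sub_rev] at h; linarith
  have adj_of_bond : ∀ a b : Fin 4, a ≠ b → cos g₁ ≤ cos (t b - t a) →
      (b = a + 1 ∨ a = b + 1) := by
    intro a b hab h
    rcases fin_four_adj_or_diag a b hab with h' | ⟨rfl, rfl⟩ | ⟨rfl, rfl⟩ | ⟨rfl, rfl⟩ |
      ⟨rfl, rfl⟩
    · exact h'
    · exact absurd h nb02
    · exact absurd h nb20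
    · exact absurd h nb13
    · exact absurd h nb31
  have c01 := adj_of_bond (q 0) (q 1) (hq.ne (by decide)) hb01
  have c12 := adj_of_bond (q 1) (q 2) (hq.ne (by decide)) hb12
  have c23 := adj_of_bond (q 2) (q 3) (hq.ne (by decide)) hb23
  -- the four cyclic gaps, indexed by their starting position
  set gap : Fin 4 → ℝ := ![t 1 - t 0, t 2 - t 1, t 3 - t 2, t 0 - t 3 + 2 * π] with hgap
  have hsum : gap 0 + gap 1 + gap 2 + gap 3 = 2 * π := by
    simp only [hgap, Matrix.cons_val]; ring
  -- each gap is `≥ g₀`, hence `< π`, and has the cosine of the corresponding step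
  have hgap_lt : ∀ a : Fin 4, gap a < π := by
    intro a
    fin_cases a <;> simp [hgap] <;> linarith
  have hgap_cos : ∀ a : Fin 4, cos (gap a) = cos (t (a + 1) - t a) := by
    intro a
    fin_cases a <;> simp [hgap]
  -- so a step of circular length `≤ G ≤ π` starting at position `a` bounds `gap a`
  have hB : ∀ (a : Fin 4) (G : ℝ), 0 ≤ G → G ≤ π → cos G ≤ cos (t (a + 1) - t a) →
      gap a ≤ G := by
    intro a G hG0 hGπ h
    rw [← hgap_cos a] at h
    exact le_of_cos_le_cos' (hgap_lt a).le hG0 h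
  -- relabelling the sum of the gaps through the bijection `q`
  have hbij : Function.Bijective q := Finite.injective_iff_bijective.mp hq
  have hsumq : gap (q 0) + gap (q 1) + gap (q 2) + gap (q 3) = 2 * π := by
    have h := Equiv.sum_comp (Equiv.ofBijective q hbij) gap
    simp only [Equiv.ofBijective_apply, Fin.sum_univ_four] at h
    rw [h, hsum]
  -- the path runs around the circle one way or the other
  rcases fin_four_path_dihedral (q 0) (q 1) (q 2) (q 3) (hq.ne (by decide)) (hq.ne (by decide))
    c01 c12 c23 with ⟨h01, h12, h23, h30⟩ | ⟨h10, h21, h32, h03⟩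
  · have b0 : gap (q 0) ≤ g₁ := hB _ _ hg₁0 hg₁π (by rw [← h01]; exact hb01)
    have b1 : gap (q 1) ≤ g₁ := hB _ _ hg₁0 hg₁π (by rw [← h12]; exact hb12)
    have b2 : gap (q 2) ≤ g₁ := hB _ _ hg₁0 hg₁π (by rw [← h23]; exact hb23)
    have b3 : gap (q 3) ≤ 2 * g₁ := hB _ _ (by linarith) h2g₁π (by rw [← h30]; exact hx)
    linarith
  · have b0 : gap (q 1) ≤ g₁ :=
      hB _ _ hg₁0 hg₁π (by rw [← h10, cos_sub_rev]; exact hb01)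
    have b1 : gap (q 2) ≤ g₁ :=
      hB _ _ hg₁0 hg₁π (by rw [← h21, cos_sub_rev]; exact hb12)
    have b2 : gap (q 3) ≤ g₁ :=
      hB _ _ hg₁0 hg₁π (by rw [← h32, cos_sub_rev]; exact hb23)
    have b3 : gap (q 0) ≤ 2 * g₁ :=
      hB _ _ (by linarith) h2g₁π (by rw [← h03, cos_sub_rev]; exact hx)
    linarith

/-- **Three steps and a double step do not close up.**  Four angles `θ k ∈ (−π, π]`, pairwise
separated (`cos (θ i − θ j) ≤ cos g₀`, `i ≠ j`), with `cos g₁ ≤ cos (θ 1 − θ 0)`,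
`cos g₁ ≤ cos (θ 2 − θ 1)`, `cos g₁ ≤ cos (θ 3 − θ 2)` (a path of short steps) and
`cos (2 g₁) ≤ cos (θ 0 − θ 3)` (the ends a double step apart), do not exist when `π/3 < g₀`,
`2 g₀ ≤ π`, `0 ≤ g₁ < 2 g₀`, `5 g₁ < 2π`.  (Sort and apply `four_sorted_path_false`.)
[folklore] -/
theorem four_path_false {g₀ g₁ : ℝ} (hg₀ : π / 3 < g₀) (h2g₀ : 2 * g₀ ≤ π) (hg₁0 : 0 ≤ g₁)
    (hg₁₀ : g₁ < 2 * g₀) (h5 : 5 * g₁ < 2 * π) (θ : Fin 4 → ℝ) (hθ : ∀ k, -π < θ k ∧ θ k ≤ π)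
    (hsep : ∀ i j, i ≠ j → cos (θ i - θ j) ≤ cos g₀) (hb01 : cos g₁ ≤ cos (θ 1 - θ 0))
    (hb12 : cos g₁ ≤ cos (θ 2 - θ 1)) (hb23 : cos g₁ ≤ cos (θ 3 - θ 2))
    (hx : cos (2 * g₁) ≤ cos (θ 0 - θ 3)) : False := by
  -- the angles are pairwise distinct
  have hcos1 : cos g₀ < 1 := by
    have := cos_lt_cos_of_nonneg_of_le_pi (le_refl 0) (by linarith) (by linarith : (0 : ℝ) < g₀)
    rwa [cos_zero] at this
  have hθinj : Function.Injective θ := by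
    intro i j hij
    by_contra hne
    have := hsep i j hne
    rw [hij, sub_self, cos_zero] at this
    linarith
  -- sort
  have hAcard : (Finset.univ.image θ).card = 4 := by
    rw [Finset.card_image_of_injective _ hθinj, Finset.card_univ, Fintype.card_fin]
  let e := (Finset.univ.image θ).orderEmbOfFin hAcard
  have hmem : ∀ i, ∃ k, e k = θ i := by
    intro i
    have hi : θ i ∈ Set.range e := by
      rw [Finset.range_orderEmbOfFin, Finset.coe_image]
      exact ⟨i, by simp, rfl⟩
    exact hi
  choose q hq using hmem
  have hqinj : Function.Injective q := by
    intro a b hab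
    apply hθinj
    rw [← hq a, ← hq b, hab]
  have hmem' : ∀ k, ∃ i, θ i = e k := by
    intro k
    have := (Finset.univ.image θ).orderEmbOfFin_mem hAcard k
    rw [Finset.mem_image] at this
    obtain ⟨i, -, hi⟩ := this
    exact ⟨i, hi⟩
  refine four_sorted_path_false hg₀ h2g₀ hg₁0 hg₁₀ h5 (fun k => e k) e.strictMono ?_ ?_ ?_ q hqinj
    ?_ ?_ ?_ ?_
  · show -π < e 0
    obtain ⟨i, hi⟩ := hmem' 0
    rw [← hi]; exact (hθ i).1
  · show e 3 ≤ π
    obtain ⟨i, hi⟩ := hmem' 3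
    rw [← hi]; exact (hθ i).2
  · intro a b hab
    obtain ⟨i, hi⟩ := hmem' a
    obtain ⟨j, hj⟩ := hmem' b
    have hne : i ≠ j := by
      rintro rfl
      exact hab (e.injective (hi.symm.trans hj))
    show cos (e a - e b) ≤ cos g₀
    rw [← hi, ← hj]
    exact hsep i j hne
  · show cos g₁ ≤ cos (e (q 1) - e (q 0))
    rw [hq, hq]; exact hb01
  · show cos g₁ ≤ cos (e (q 2) - e (q 1))
    rw [hq, hq]; exact hb12
  · show cos g₁ ≤ cos (e (q 3) - e (q 2))
    rw [hq, hq]; exact hb23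
  · show cos (2 * g₁) ≤ cos (e (q 0) - e (q 3))
    rw [hq, hq]; exact hx

end Summit.AtomisticToContinuum.Crystallization.Theorems
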